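import Summits.ABC.IUTFork.Thm311RealInd1StripDepthEFixed
import HarnessLib

/-!
# [IUTchIII] Thm 3.11 (i) (Ind1)+(Ind2) at `v ∈ 𝕍^non`: the DEPTH-`e` DICHOTOMY at residue degree one — if SOME realised strip automorphism
# moves the base line modulo `𝔪_v^{e+1}`, the strip orbit span of the depth-`e` ball has the CONTAINER's hull (modulo
# `JannsenWingbergMappingClass`); the bit is an EQUIVALENCE

PROOF-ONLY file (abc-iut cell, Cor. 3.12 sub-crew, seat abc-iut-c312-1 = holder of record of the typed [IUTchIII] Thm. 3.11, gen 18; row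
«R24 = C:F1-DEPTH-E-DICHOTOMY», KEY F1DICHOTOMY, C LEAD ruling C-R152 (f); file 2 of the row — file 1 `Thm311RealInd1StripDepthEFixed` is the
unconditional branch).  TAKES NO SIDE on [IUTchIII] Cor. 3.12.

SETTING (as in file 1).  One tame place `v ∣ p` (`p > 2`, `e = e(v|p) ≤ p − 2`, `log_p(𝒪_v^×) = 𝔪_v`), the DEPTH-`e` ball `M = {‖x‖ ≤ ‖c‖·p⁻¹}`
(`= c·𝔪_v^e = p·c·𝒪_v`, `c ≠ 0`), and THE BIT «some `ψ ∈ Real.ind1StripOf v (galoisLog v)` moves the base line `ℤ_p·p = log_p(1+pℤ_p)` modulo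
`p·log_p(𝒪_v^×) = 𝔪_v^{e+1}`» (`ψ(p) − p ∉ p·log_p(𝒪_v^×)`; one displayed binder, no new `Prop`).

* §2 (modulo `JannsenWingbergMappingClass`, odd local degree `≥ 3`; NO residue-degree hypothesis) **`smul_inter_ker_subset_of_depthE_ball_of_movesBaseLine_of_jannsenWingbergMappingClass`**
  — if the bit holds, EVERY additive subgroup `N ⊇ M` stable under the realised strip automorphisms CONTAINS the floor `c·(log_p(𝒪_v^×) ∩ Ker Tr)`
  and an element of the container radius `‖c‖·p^{−1/e}`, and — if inside the ceiling `M + (c·log_p(𝒪_v^×) ∩ Ker Tr)` (p516833 §1: the orbit span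
  is) — has the container's `𝒪_{K_v}`-hull `closedBall 0 (‖c‖·p^{−1/e})` (`= c·𝔪_v`).  Mechanism: for the mover `ψ₁`, the displacements
  `ψ₁(p·c·u) − p·c·u = u·c·(ψ₁(p) − p)` (`u ∈ ℤ_p`) lie in `N`; `w₁ = ψ₁(p) − p` is a trace-zero log-unit (R13/R17b §1, unconditional) OFF
  `p·log_p(𝒪_v^×)`, so — box property of the basis of `exists_basis_hullFloor_of_jannsenWingbergMappingClass` (p528939) and the vanishing of its
  radial coordinate on `Ker Tr` — it has a plane coordinate of MAXIMAL norm among those of `log_p(𝒪_v^×)`: the enlarged region `M ∪ ℤ_p·c·w₁ ⊆ N`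
  is in general position and gen 15's floor theorem applies verbatim.  (At `f(v|p) ≠ 1` the floor holds without the bit: p533915.)
* §3 (modulo `JannsenWingbergMappingClass`; `f(v|p) = 1`, odd local degree `≥ 3`) **`exists_movesBaseLine_iff_exists_depthE_ball_moved_of_jannsenWingbergMappingClass`**
  — THE DICHOTOMY AS AN EQUIVALENCE: the bit holds IFF some realised strip automorphism moves some point of the depth-`e` ball `M` out of `M`.
  (⇒: by §2 the ball itself, were it strip-stable, would contain an element of norm `‖c‖·p^{−1/e} > ‖c‖·p⁻¹` — `e = [K_v:ℚ_p] ≥ 3` at residue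
  degree one; ⇐: file 1.)  So, by file 1 and §2: EITHER no strip automorphism moves the base line mod `𝔪_v^{e+1}` and the strip orbit span of
  `M` is `M` (hull `closedBall 0 (‖c‖·p⁻¹)`, defect `e − 1` steps of `𝔪_v` against the container), OR one does and every strip-stable `N ⊇ M`
  inside the ceiling has the container's hull `closedBall 0 (‖c‖·p^{−1/e})` — tertium non datur, and which branch holds is ONE bit on the realised
  strip group that print does not pin (Kondo 2025 p. 5 records the exact base-line question at odd degree as open).
READING (numbers about OUR typed objects, one finite place; neutral): the f = 1 depth-`e` residue of gens 15–17 is now a displayed hypothesis with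
both branches computed; nothing here decides it. HONEST SCOPE: conditional on `hMC` (Kondo 2025 §3 over Farb–Margalit Thm. 6.4 + Jannsen–Wingberg;
flag (α)); single place; tame; odd local degree; OUR typing of print's (Ind1)/(Ind2) (THE equivariant lift, THE logarithm; referee F-B28-1
untouched); statements about OUR typed strip group, not about print's indeterminacy group; no log-volume computed here; (Ind3) and the log-link
untouched; no side taken on [IUTchIII] Cor. 3.12 / [IUTchIV] Thm. 1.10 or on any author; NO abc claim. [claim: Mochizuki2012, status: disputed];
[cite: Mochizuki2012, IUTchIII Thm. 3.11 (i) p. 154; Rmk. 3.9.5 (i) p. 126; Cor. 3.12 Step (xi) p. 183; IUTchIV Prop. 1.2 (i)–(ii) pp. 10–11];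
[cite: Kondo2025OuterAutMLF, §3 Thm 3.17, Rem 3.18; p. 5]; [cite: FarbMargalit2012, Thm 6.4 p.147]; [cite: DupuyHilado2025, §4.9, §4.12];
[cite: SerreLocalFields1979, Ch. III §6, Prop. 13]. typed ≠ proved; a conditional theorem discharges nothing it binds; equal-AS-TYPED ≠ equal in print.
-/

set_option autoImplicit false

noncomputable section

open Metric Set
open scoped Pointwise

namespace Summit.ABC.IUTFork.Thm311.Real

open NumberField IsDedekindDomain Literature.NumberTheory.NumberFields Literature.IUT.LogVolume
open Literature.NumberTheory.GaloisRepresentations Literature.NumberTheory.GaloisRepresentations.Ultrametric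
open Literature.AnabelianGeometry.AbsoluteAnabelian Literature.IUT.HodgeArakelov
open Literature.IUT.HodgeArakelov.AbsTopMonoids

variable {F : Type} [Field F] [NumberField F] (v : HeightOneSpectrum (𝓞 F))

/-! ## §2 Modulo `JannsenWingbergMappingClass`: a base-line mover RESTORES general position — the floor and the container's hull -/

set_option maxHeartbeats 400000 in
/-- **BRANCH (i) OF THE DICHOTOMY (modulo `JannsenWingbergMappingClass`): a base-line mover ⇒ the floor and the container's hull.**  At a tame
place `v ∣ p` (`p > 2`, `e = e(v|p) ≤ p − 2`) of ODD local degree `≥ 3` (no residue-degree hypothesis), for a content `c ≠ 0`: if SOME `ψ` in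
print's (Ind1) strip part `Real.ind1StripOf v (galoisLog v)` moves the base line modulo `p·log_p(𝒪_v^×) = 𝔪_v^{e+1}` (`ψ(p) − p ∉ p·log_p(𝒪_v^×)`),
then every additive subgroup `N` containing the depth-`e` ball `M = {‖x‖ ≤ ‖c‖·p⁻¹}` (`= c·𝔪_v^e`) and stable under every realised strip
automorphism CONTAINS the floor `c·(log_p(𝒪_v^×) ∩ Ker Tr)` and an element of norm `‖c‖·p^{−1/e}` (the container radius); and if `N` lies inside
the ceiling `M + (c·log_p(𝒪_v^×) ∩ Ker Tr)`, its `𝒪_{K_v}`-module hull IS the hull of Dupuy–Hilado's container span `c·log_p(𝒪_v^×)`, the ball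
`closedBall 0 (‖c‖·p^{−1/e})` (`= c·𝔪_v`).  [claim: Mochizuki2012, status: disputed] [cite: Mochizuki2012, IUTchIII Thm. 3.11 (i) p. 154;
Rmk. 3.9.5 (i) p. 126; Cor. 3.12 Step (xi) p. 183] [cite: Kondo2025OuterAutMLF, §3 Thm 3.17, Rem 3.18] [cite: DupuyHilado2025, §4.9, §4.12] -/
theorem smul_inter_ker_subset_of_depthE_ball_of_movesBaseLine_of_jannsenWingbergMappingClass (hMC : JannsenWingbergMappingClass)
    (p : ℕ) [Fact p.Prime] (hv : ((p : ℕ) : 𝓞 F) ∈ v.asIdeal) (hp2 : 2 < p)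
    (he : absRamificationIdx p (RescaledCompletion F p v hv) ≤ p - 2) (h3 : 3 ≤ localDeg F v) (hodd : Odd (localDeg F v))
    {c : ℚ_[p]} (hc : c ≠ 0)
    (hbit : ∃ ψ ∈ ind1StripOf v (galoisLog v),
      RescaledCompletion.of F p v hv (ψ (p : v.adicCompletion F)) - (p : RescaledCompletion F p v hv) ∉
        (p : ℚ_[p]) • logUnits (RescaledCompletion F p v hv))
    (N : AddSubgroup (RescaledCompletion F p v hv))
    (hMN : ∀ x : v.adicCompletion F, ‖RescaledCompletion.of F p v hv x‖ ≤ ‖c‖ * (p : ℝ)⁻¹ → RescaledCompletion.of F p v hv x ∈ N)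
    (hN : ∀ ψ ∈ ind1StripOf v (galoisLog v), ∀ n ∈ N,
      RescaledCompletion.of F p v hv (ψ ((RescaledCompletion.of F p v hv).symm n)) ∈ N) :
    c • (logUnits (RescaledCompletion F p v hv) ∩ {w | Algebra.trace ℚ_[p] (RescaledCompletion F p v hv) w = 0}) ⊆
        (N : Set (RescaledCompletion F p v hv)) ∧
    (∃ y ∈ N, ‖y‖ = ‖c‖ * (p : ℝ) ^ (-(1 / (absRamificationIdx p (RescaledCompletion F p v hv) : ℝ)))) ∧
    ((N : Set (RescaledCompletion F p v hv)) ⊆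
      {x | ‖x‖ ≤ ‖c‖ * (p : ℝ)⁻¹} +
        (c • logUnits (RescaledCompletion F p v hv) ∩ {w | Algebra.trace ℚ_[p] (RescaledCompletion F p v hv) w = 0}) →
    (Submodule.span (Valued.integer (RescaledCompletion F p v hv)) (N : Set (RescaledCompletion F p v hv)) :
        Set (RescaledCompletion F p v hv)) =
      Submodule.span (Valued.integer (RescaledCompletion F p v hv)) (c • logUnits (RescaledCompletion F p v hv)) ∧
    (Submodule.span (Valued.integer (RescaledCompletion F p v hv)) (c • logUnits (RescaledCompletion F p v hv)) :
        Set (RescaledCompletion F p v hv)) =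
      closedBall 0 (‖c‖ * (p : ℝ) ^ (-(1 / (absRamificationIdx p (RescaledCompletion F p v hv) : ℝ))))) := by
  obtain ⟨g, hg, y, -, -, hco, hbox, hrec, hH⟩ :=
    exists_basis_hullFloor_of_jannsenWingbergMappingClass v hMC p hv hp2 he h3 hodd
  set R := RescaledCompletion F p v hv
  set e := RescaledCompletion.of F p v hv with he_def
  set E := absRamificationIdx p (RescaledCompletion F p v hv) with hE_def
  set r : ℝ := ‖c‖ * (p : ℝ)⁻¹ with hr_def
  let pl : Fin g ⊕ Fin g → Fin g × Fin 2 := Sum.elim (fun i => (i, 0)) (fun i => (i, 1))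
  haveI : FiniteDimensional ℚ_[p] R := FiniteDimensional.of_locallyCompactSpace ℚ_[p]
  have hP : p.Prime := Fact.out
  have hp1 : (1 : ℝ) < p := by exact_mod_cast hP.one_lt
  have hp0 : (0 : ℝ) < p := by positivity
  have hpQ : (p : ℚ_[p]) ≠ 0 := by exact_mod_cast hP.ne_zero
  have hc0 : 0 < ‖c‖ := norm_pos_iff.mpr hc
  have hr0 : 0 < r := by positivity
  have hd2 : 2 ≤ localDeg F v := by omega
  -- tame: `log_p(𝒪_v^×) = {‖z‖ < 1}`, a `ℤ_p`-module, closed under sums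
  have hL : ∀ z : R, z ∈ logUnits R ↔ ‖z‖ < 1 := fun z => mem_logUnits_iff_norm_lt_one_of_tame p hp2 he z
  have hLsmul : ∀ (u : ℚ_[p]) (z : R), ‖u‖ ≤ 1 → z ∈ logUnits R → u • z ∈ logUnits R := by
    intro u z hu hz
    set u' : ℤ_[p] := ⟨u, hu⟩ with hu'
    have h := smul_mem_logUnits p R u' hz
    rwa [← algebraMap_smul ℚ_[p] u' z] at h
  have hpLadd : ∀ a b : R, a ∈ (p : ℚ_[p]) • logUnits R → b ∈ (p : ℚ_[p]) • logUnits R → a + b ∈ (p : ℚ_[p]) • logUnits R := by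
    intro a b ha hb
    obtain ⟨a', ha', rfl⟩ := Set.mem_smul_set.mp ha
    obtain ⟨b', hb', rfl⟩ := Set.mem_smul_set.mp hb
    rw [← smul_add]
    exact Set.smul_mem_smul_set ((logUnitsAddSubgroup p R).add_mem (show a' ∈ logUnitsAddSubgroup p R from ha')
      (show b' ∈ logUnitsAddSubgroup p R from hb'))
  -- `p ∈ log_p(𝒪_v^×)` (tame)
  have hpR : (p : R) = (p : ℚ_[p]) • (1 : R) := by
    rw [← map_natCast (algebraMap ℚ_[p] R) p, Algebra.algebraMap_eq_smul_one]
  have hpL : (p : R) ∈ logUnits R := (hL _).mpr (by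
    rw [hpR, norm_smul, norm_one, mul_one, Padic.norm_p]; exact inv_lt_one_of_one_lt₀ hp1)
  have hep : e (p : v.adicCompletion F) = (p : R) := map_natCast e p
  -- the mover `ψ₁` and its displacement `w₁ = ψ₁(p) − p`: a trace-zero log-unit off `p·log_p(𝒪_v^×)`
  obtain ⟨ψ₁, hψ₁, hw₁⟩ := hbit
  set w₁ : R := e (ψ₁ (p : v.adicCompletion F)) - (p : R) with hw₁_def
  have hpL1 : e (p : v.adicCompletion F) ∈ (1 : ℚ_[p]) • logUnits R := by rw [one_smul, hep]; exact hpL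
  obtain ⟨hw₁L, hw₁T⟩ := sub_mem_smul_logUnits_inter_ker_trace_of_mem_ind1StripOf v p hv hψ₁ 1 hpL1
  rw [one_smul, hep] at hw₁L
  rw [hep] at hw₁T
  -- `ψ₁` read on `R`, `ℚ_p`-linear by continuity
  obtain ⟨hcont₁, -, -, -⟩ := id hψ₁
  let f₁ : R →+ R :=
    { toFun := fun a => e (ψ₁ (e.symm a))
      map_zero' := by rw [map_zero, map_zero, map_zero]
      map_add' := fun a b => by rw [map_add, map_add, map_add] }
  have hf₁c : Continuous f₁ := hcont₁
  have hf₁_smul : ∀ (a : ℚ_[p]) (z : R), f₁ (a • z) = a • f₁ z := fun a z => map_padic_smul_of_continuous p f₁ hf₁c a z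
  have hw₁f : w₁ = f₁ ((p : ℚ_[p]) • (1 : R)) - (p : ℚ_[p]) • (1 : R) := by
    rw [hw₁_def, ← hpR]
    show e (ψ₁ (p : v.adicCompletion F)) - (p : R) = e (ψ₁ (e.symm (p : R))) - (p : R)
    rw [map_natCast e.symm]
  -- the scaled base points `p·c·u`, `u ∈ ℤ_p`, lie in `M`, and `ψ₁` displaces them by `u·(c·w₁)`; hence `ℤ_p·(c·w₁) ⊆ N`
  have hmove : ∀ u : ℚ_[p], ‖u‖ ≤ 1 →
      ‖e (e.symm (((p : ℚ_[p]) * c * u) • (1 : R)))‖ ≤ r ∧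
        e (ψ₁ (e.symm (((p : ℚ_[p]) * c * u) • (1 : R)))) - e (e.symm (((p : ℚ_[p]) * c * u) • (1 : R))) = u • (c • w₁) := by
    intro u hu
    refine ⟨?_, ?_⟩
    · rw [e.apply_symm_apply, norm_smul, norm_one, mul_one, norm_mul, norm_mul, Padic.norm_p, hr_def]
      calc (p : ℝ)⁻¹ * ‖c‖ * ‖u‖ ≤ (p : ℝ)⁻¹ * ‖c‖ * 1 := by gcongr
        _ = ‖c‖ * (p : ℝ)⁻¹ := by ring
    · rw [e.apply_symm_apply]
      have hsc : ((p : ℚ_[p]) * c * u) • (1 : R) = (c * u) • ((p : ℚ_[p]) • (1 : R)) := by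
        rw [smul_smul]; congr 1; ring
      rw [hsc]
      show f₁ ((c * u) • ((p : ℚ_[p]) • (1 : R))) - (c * u) • ((p : ℚ_[p]) • (1 : R)) = u • (c • w₁)
      rw [hf₁_smul, ← smul_sub, ← hw₁f, smul_smul, mul_comm u c]
  have hucw : ∀ u : ℚ_[p], ‖u‖ ≤ 1 → u • (c • w₁) ∈ N := by
    intro u hu
    obtain ⟨hxu, hdu⟩ := hmove u hu
    have h1 : e (e.symm (((p : ℚ_[p]) * c * u) • (1 : R))) ∈ N := hMN _ hxu
    have h2 : e (ψ₁ (e.symm (((p : ℚ_[p]) * c * u) • (1 : R)))) ∈ N := by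
      have h := hN ψ₁ hψ₁ _ h1
      rwa [e.symm_apply_apply] at h
    rw [← hdu]
    exact N.sub_mem h2 h1
  -- a maximal plane coordinate `i` over `log_p(𝒪_v^×)` (compactness), with `i·y_k ∈ log_p(𝒪_v^×)` (box property)
  have hLc : IsCompact (logUnits R) := isCompact_logUnits (p := p) R
  have hLne : (logUnits R).Nonempty := ⟨0, zero_mem_logUnits (p := p)⟩
  have hmax : ∀ k : Fin g ⊕ Fin g, ∃ z ∈ logUnits R, IsMaxOn (fun w => ‖y.coord (Sum.inr (pl k)) w‖) (logUnits R) z := by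
    intro k
    exact hLc.exists_isMaxOn hLne
      ((continuous_norm.comp (y.coord (Sum.inr (pl k))).continuous_of_finiteDimensional).continuousOn)
  choose zk hzk hzkmax using hmax
  haveI : Nonempty (Fin g ⊕ Fin g) := by
    have hg1 : 1 ≤ g := by omega
    exact ⟨Sum.inl ⟨0, hg1⟩⟩
  obtain ⟨k₁, -, hk₁⟩ := Finset.exists_max_image Finset.univ
    (fun k : Fin g ⊕ Fin g => ‖y.coord (Sum.inr (pl k)) (zk k)‖) Finset.univ_nonempty
  set i : ℚ_[p] := y.coord (Sum.inr (pl k₁)) (zk k₁) with hi_def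
  have hi : ∀ z ∈ logUnits R, ∀ k : Fin g ⊕ Fin g, ‖y.coord (Sum.inr (pl k)) z‖ ≤ ‖i‖ :=
    fun z hz k => (hzkmax k hz).trans (hk₁ k (Finset.mem_univ k))
  have hiy : ∀ k : Fin g ⊕ Fin g, i • y (Sum.inr (pl k)) ∈ logUnits R := fun k => hbox (zk k₁) (hzk k₁) k₁ k
  -- `w₁` has a plane coordinate of MAXIMAL norm: otherwise (p-adic gap + box + zero radial coordinate) `w₁ ∈ p·log_p(𝒪_v^×)`
  have hGPw : ∃ j₀ : Fin g ⊕ Fin g, ‖i‖ ≤ ‖y.coord (Sum.inr (pl j₀)) w₁‖ := by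
    by_contra hcon
    push Not at hcon
    apply hw₁
    have hi0 : i ≠ 0 := by
      intro h0
      have h := hcon k₁
      rw [h0, norm_zero] at h
      exact (norm_nonneg _).not_gt h
    have hpi0 : (p : ℚ_[p]) * i ≠ 0 := mul_ne_zero hpQ hi0
    have hterm : ∀ k, y.coord (Sum.inr (pl k)) w₁ • y (Sum.inr (pl k)) ∈ (p : ℚ_[p]) • logUnits R := by
      intro k
      set t := y.coord (Sum.inr (pl k)) w₁ with ht
      have htn : ‖t‖ ≤ ‖(p : ℚ_[p]) * i‖ := by
        have h := Hull.padic_norm_le_of_norm_lt (hcon k)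
        rwa [norm_mul, Padic.norm_p]
      set u : ℚ_[p] := t / ((p : ℚ_[p]) * i) with hu_def
      have hu : ‖u‖ ≤ 1 := by
        rw [hu_def, norm_div, div_le_one (norm_pos_iff.mpr hpi0)]
        exact htn
      have htu : t = (p : ℚ_[p]) * (u * i) := by
        rw [hu_def]
        calc t = t / ((p : ℚ_[p]) * i) * ((p : ℚ_[p]) * i) := (div_mul_cancel₀ t hpi0).symm
          _ = (p : ℚ_[p]) * (t / ((p : ℚ_[p]) * i) * i) := by ring
      rw [htu, mul_smul, mul_smul]
      exact Set.smul_mem_smul_set (hLsmul u _ hu (hiy k))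
    have hsum : ∀ s : Finset (Fin g ⊕ Fin g),
        ∑ k ∈ s, y.coord (Sum.inr (pl k)) w₁ • y (Sum.inr (pl k)) ∈ (p : ℚ_[p]) • logUnits R := by
      intro s
      induction s using Finset.induction_on with
      | empty =>
        rw [Finset.sum_empty, ← smul_zero (p : ℚ_[p])]
        exact Set.smul_mem_smul_set (zero_mem_logUnits (p := p))
      | insert a s ha ih =>
        rw [Finset.sum_insert ha]
        exact hpLadd _ _ (hterm a) ih
    have hco0 : y.coord (Sum.inl 0) w₁ = 0 := hco w₁ hw₁T
    rw [← hrec w₁, hco0, zero_smul, zero_add]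
    exact hsum Finset.univ
  obtain ⟨j₀, hj₀⟩ := hGPw
  -- the enlarged region `M' = M ∪ ℤ_p·(c·w₁)` is in general position, `ℤ_p`-stable, inside `N`, and two-step closed into `N`
  let M' : Set (v.adicCompletion F) := {x | ‖e x‖ ≤ r} ∪ {x | ∃ u : ℚ_[p], ‖u‖ ≤ 1 ∧ e x = u • (c • w₁)}
  have hMs' : ∀ u : ℚ_[p], ‖u‖ ≤ 1 → ∀ x ∈ M', e.symm (u • e x) ∈ M' := by
    intro u hu x hx
    rcases hx with hx | ⟨u', hu', hx⟩
    · left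
      change ‖e (e.symm (u • e x))‖ ≤ r
      rw [e.apply_symm_apply, norm_smul]
      calc ‖u‖ * ‖e x‖ ≤ 1 * r := mul_le_mul hu hx (norm_nonneg _) zero_le_one
        _ = r := one_mul r
    · right
      refine ⟨u * u', ?_, ?_⟩
      · rw [norm_mul]; exact mul_le_one₀ hu (norm_nonneg _) hu'
      · rw [e.apply_symm_apply, hx, smul_smul]
  have hGP' : ∃ x₀ ∈ M', ∃ j : Fin g ⊕ Fin g, ∀ z ∈ logUnits R, ∀ k : Fin g ⊕ Fin g,
      ‖y.coord (Sum.inr (pl k)) (c • z)‖ ≤ ‖y.coord (Sum.inr (pl j)) (e x₀)‖ := by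
    refine ⟨e.symm (c • w₁), Or.inr ⟨1, by rw [norm_one], by rw [e.apply_symm_apply, one_smul]⟩, j₀, fun z hz k => ?_⟩
    rw [e.apply_symm_apply, map_smul, map_smul, smul_eq_mul, smul_eq_mul, norm_mul, norm_mul]
    exact mul_le_mul_of_nonneg_left ((hi z hz k).trans hj₀) (norm_nonneg _)
  have hMN' : ∀ x ∈ M', e x ∈ N := by
    intro x hx
    rcases hx with hx | ⟨u, hu, hx⟩
    · exact hMN x hx
    · rw [hx]; exact hucw u hu
  have horb' : ∀ ψ ∈ ind1StripOf v (galoisLog v), ∀ x ∈ M',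
      e (ψ x) ∈ N ∧ ∀ ψ' ∈ ind1StripOf v (galoisLog v), e (ψ' (ψ x)) ∈ N := by
    intro ψ hψ x hx
    have h1 : e (ψ x) ∈ N := by
      have h := hN ψ hψ _ (hMN' x hx)
      rwa [e.symm_apply_apply] at h
    refine ⟨h1, fun ψ' hψ' => ?_⟩
    have h := hN ψ' hψ' _ h1
    rwa [e.symm_apply_apply] at h
  obtain ⟨hfloor, hfull, hhull⟩ := hH c M' N hMs' hGP' hMN' horb'
  refine ⟨hfloor, hfull, fun hNc => ?_⟩
  -- the hull, under the ceiling hypothesis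
  have hpn : (p : ℝ)⁻¹ < 1 := inv_lt_one_of_one_lt₀ hp1
  have hballc : ∀ x : R, ‖x‖ ≤ r → x ∈ c • logUnits R := by
    intro x hx
    refine ⟨c⁻¹ • x, (hL _).mpr ?_, by change c • (c⁻¹ • x) = x; rw [smul_smul, mul_inv_cancel₀ hc, one_smul]⟩
    rw [norm_smul, norm_inv, inv_mul_lt_iff₀ hc0]
    calc ‖x‖ ≤ r := hx
      _ < ‖c‖ * 1 := by rw [hr_def]; exact mul_lt_mul_of_pos_left hpn hc0
  have hMc' : ∀ x ∈ M', e x ∈ c • logUnits R := by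
    intro x hx
    rcases hx with hx | ⟨u, hu, hx⟩
    · exact hballc (e x) hx
    · rw [hx, smul_comm u c w₁]
      exact Set.smul_mem_smul_set (hLsmul u _ hu hw₁L)
  have heM' : ({x : R | ‖x‖ ≤ r} : Set R) ⊆ e '' M' := fun x hx =>
    ⟨e.symm x, Or.inl (by change ‖e (e.symm x)‖ ≤ r; rwa [e.apply_symm_apply]), e.apply_symm_apply x⟩
  have hNc' : (N : Set R) ⊆ e '' M' + (c • logUnits R ∩ {w | Algebra.trace ℚ_[p] R w = 0}) :=
    hNc.trans (Set.add_subset_add_right heM')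
  have h0 : (0 : R) ∈ ({x : R | ‖x‖ ≤ r} : Set R) := by
    rw [Set.mem_setOf_eq, norm_zero]; exact hr0.le
  exact ⟨hhull hMc' hNc', (coe_span_add_inter_ker_eq_of_tame v p hv hp2 he hd2 c h0 (fun x hx => hballc x hx)).2⟩

/-! ## §3 The dichotomy as an EQUIVALENCE (modulo `JannsenWingbergMappingClass`, residue degree one) -/

/-- **THE DEPTH-`e` DICHOTOMY (modulo `JannsenWingbergMappingClass`).**  At a tame place `v ∣ p` (`p > 2`, `e(v|p) ≤ p − 2`) of residue degree
`f(v|p) = 1` and ODD local degree `≥ 3` (so `e = [K_v:ℚ_p] ≥ 3`), for a content `c ≠ 0`: SOME `ψ` in print's (Ind1) strip part moves the base line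
`ℤ_p·p` modulo `p·log_p(𝒪_v^×) = 𝔪_v^{e+1}` IFF SOME `ψ` in it moves SOME point of the depth-`e` ball `M = {‖x‖ ≤ ‖c‖·p⁻¹}` (`= c·𝔪_v^e`) OUT of
`M`.  (⇒ §2: a strip-stable `M` would contain an element of the container radius `‖c‖·p^{−1/e} > ‖c‖·p⁻¹`; ⇐ file 1: with no base-line mover
every `ψ` maps `M` into itself.)  With file 1 and §2 this is the two-sided dichotomy: the strip orbit span of `M` is EITHER `M` itself (hull
`closedBall 0 (‖c‖·p⁻¹)`) OR has the container's hull `closedBall 0 (‖c‖·p^{−1/e})`, according to this one bit on the realised strip group.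
[claim: Mochizuki2012, status: disputed] [cite: Mochizuki2012, IUTchIII Thm. 3.11 (i) p. 154; Cor. 3.12 Step (xi) p. 183]
[cite: Kondo2025OuterAutMLF, §3 Thm 3.17, Rem 3.18; p. 5] [cite: DupuyHilado2025, §4.9, §4.12] -/
theorem exists_movesBaseLine_iff_exists_depthE_ball_moved_of_jannsenWingbergMappingClass (hMC : JannsenWingbergMappingClass)
    (p : ℕ) [Fact p.Prime] (hv : ((p : ℕ) : 𝓞 F) ∈ v.asIdeal) (hp2 : 2 < p)
    (he : absRamificationIdx p (RescaledCompletion F p v hv) ≤ p - 2) (h3 : 3 ≤ localDeg F v) (hodd : Odd (localDeg F v))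
    (hf : v.asIdeal.inertiaDeg ℤ = 1) {c : ℚ_[p]} (hc : c ≠ 0) :
    (∃ ψ ∈ ind1StripOf v (galoisLog v),
      RescaledCompletion.of F p v hv (ψ (p : v.adicCompletion F)) - (p : RescaledCompletion F p v hv) ∉
        (p : ℚ_[p]) • logUnits (RescaledCompletion F p v hv)) ↔
    ∃ ψ ∈ ind1StripOf v (galoisLog v), ∃ x : v.adicCompletion F,
      ‖RescaledCompletion.of F p v hv x‖ ≤ ‖c‖ * (p : ℝ)⁻¹ ∧ ‖c‖ * (p : ℝ)⁻¹ < ‖RescaledCompletion.of F p v hv (ψ x)‖ := by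
  set R := RescaledCompletion F p v hv
  set e := RescaledCompletion.of F p v hv with he_def
  set E := absRamificationIdx p (RescaledCompletion F p v hv) with hE_def
  set r : ℝ := ‖c‖ * (p : ℝ)⁻¹ with hr_def
  constructor
  · intro hbit
    by_contra hcon
    push Not at hcon
    -- the ball as an additive subgroup, strip-stable by `hcon`
    let N : AddSubgroup R :=
      { carrier := {z | ‖z‖ ≤ r}
        zero_mem' := by change ‖(0 : R)‖ ≤ r; rw [norm_zero]; positivity
        add_mem' := fun {a b} ha hb => (IsUltrametricDist.norm_add_le_max a b).trans (max_le ha hb)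
        neg_mem' := fun {a} ha => by change ‖-a‖ ≤ r; rw [norm_neg]; exact ha }
    obtain ⟨-, ⟨y, hyN, hyn⟩, -⟩ :=
      smul_inter_ker_subset_of_depthE_ball_of_movesBaseLine_of_jannsenWingbergMappingClass v hMC p hv hp2 he h3 hodd hc hbit N
        (fun x hx => hx) (fun ψ hψ n hn => hcon ψ hψ (e.symm n) (by rwa [e.apply_symm_apply]))
    -- `e = [K_v:ℚ_p] ≥ 3` at residue degree one, so the container radius exceeds `M`'s
    have hE2 : 2 ≤ E := by
      have h1 := absRamificationIdx_mul_residueDegree p R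
      have h2 := residueDegree_rescaledCompletion F p v hv
      change residueDegree p R = _ at h2
      rw [h2, hf, mul_one, finrank_rescaledCompletion_eq_localDeg] at h1
      change E = localDeg F v at h1
      omega
    have hlt := (coe_span_depthE_ball_eq_closedBall v p hv c).2 hE2 hc
    change ‖y‖ ≤ r at hyN
    rw [hyn] at hyN
    exact absurd hyN (not_le.mpr hlt)
  · rintro ⟨ψ, hψ, x, hx, hlt⟩
    by_contra hcon
    push Not at hcon
    have h := (of_apply_sub_mem_smul_logUnits_of_fixesBaseLine v p hv hp2 he hf hc hcon hψ hx).2.2.2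
    exact absurd h (not_le.mpr hlt)

end Summit.ABC.IUTFork.Thm311.Real

end
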